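import Summits.Ventures.CertifiedQuantumChemistry.Rows.LinearCombination
import Literature.MathematicalPhysics.QuantumChemistry.RelaxationEnergyHierarchy
import HarnessLib

/-!
# Barrier (structural, PROVED), part 1 of 3: the ADDITIVITY FLOOR of same-class difference pencils —
# linearity of the energy functional in the table file and the POINTWISE ceiling / floor of the
# `dE-direct:d` legs (any relaxation class); LADDER-CHEM §2 «door A»

Barrier record of the venture `Summits/Ventures/CertifiedQuantumChemistry` (LADDER-CHEM, HUMAN RULING
D-0105 (1); rung X1 "BARRIERS placed … each names its door"), directory `Barriers/` (venture-side:
the objects — `Model`, `Model.lincomb`, `UpperRow`, the pencil rows of `Rows/DifferencePencilRows.lean`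
— are the venture's). Typer chem-type-10 (I-TYPE slot 10 (iii) / X1 item (6)), gen 3. THREE FILES
(lint: files with proofs ≤ 400 lines): this file (§1 linearity, §2 pointwise any-class form);
`Barriers/DifferencePencilCeilingDQG.lean` (value form for the DQG class: «the bracket always contains
P_A − P_B», width floors, the barrier `Prop` + `_holds`); `Barriers/DifferencePencilCeilingT1T2p.lean`
(value form for the DQGT1T2′ class).

HONEST FRAMING of that venture (verbatim): certified bounds for a stated model Hamiltonian in a stated
basis; not a claim about the real molecule or material beyond that model. Nothing in these files is a
number about any file; they are a kernel-checked LIMITATION of one certificate class, with its doors.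

## What is typed (in-house source, as printed)

chem-solver-4, `HOME/solver/diff/DESIGN.md` §1 «EXPECTED WIDTH — two PROVEN floors + one MEASURED
law» (sha16 5262a768ac94f1c1, 2026-08-26), floor (F2), verbatim: «(F2) additivity floor:
L_R(K⁺_μ) + L_R(F_B) ≤ L_R((1+μ)F_A) = (1+μ)L_R(F_A) (a min is superadditive, positively homogeneous)
⇒ the pencil lower bound ≤ [L_R(A) − L_R(B)] − μW_A and the upper ≥ [L_R(A) − L_R(B)] + νW_B ⇒
W(D) ≥ μW_A + νW_B, and the bracket always contains L_R(A) − L_R(B) (the naive difference of relaxed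
optima) as well as D». Here `R` is a relaxation class (a FIXED set of abstract pairs `(γ, Γ)`, e.g. the
cell's DQG = `IsDQGFeasibleSector a b` or DQGT1T2′ = `IsDQGT1T2PrimeFeasibleSector a b`), `L_R(F)` /
`P_F` its optimal value on the file `F` (`Model.pqgSectorEnergy`, `pqgT1T2pSectorEnergy`), `K⁺_μ =
(1+μ)·F_A − F_B` the pencil file (`Model.lincomb c (-1) F_A F_B`, `c = 1 + μ ≥ 1`), `D = E₀(A) − E₀(B)`
the certified difference, and the pencil rows are those PROVED SOUND by chem-type-09
(`diffLowerRow_of_pencil_of_upperRow`: `ℓ − (c−1)·u_A ≤ D`; `diffUpperRow_of_pencil_of_upperRow`: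
`D ≤ (c′−1)·u_B − ℓ′`). (F1), the Rayleigh floor, is `Model.energy_pencil_le` (in tree); the measured
LAW is quoted in part 2 as locators only.

## This file (all PROVED; 0 sorry; no definition)

* §1 LINEARITY of the cell's energy functional in the table file: `E_{α·F+β·G}(γ,Γ) = α·E_F(γ,Γ) +
  β·E_G(γ,Γ)` (`rdmEnergy_zero_tables`, `rdmEnergy_smul_tables`, `Model.rdmEnergy_lincomb`, real parts
  `Model.re_rdmEnergy_lincomb`, pencil form `Model.re_rdmEnergy_pencil`) — the one identity the three
  files rest on («K± = exact term-by-term rational combination of the literal tables», DESIGN §1).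
* §2 POINTWISE CEILING / FLOOR (any class, no infimum, no symmetry hypothesis): if the pencil value
  `ℓ` is certified AT an abstract pair `x = (γ, Γ)` (`ℓ ≤ Re E_K(x)`, which every dual certificate of a
  class containing `x` delivers), then
  `ℓ − (c−1)·u_A ≤ [Re E_A(x) − Re E_B(x)] − (c−1)·(u_A − Re E_A(x))` (`pencilLower_le_pointwise`),
  hence `≤ Re E_A(x) − Re E_B(x)` whenever `c ≥ 1` and `Re E_A(x) ≤ u_A` (`pencilLower_le_pointwise'`);
  mirror statements for the upper leg (`pencilUpper_ge_pointwise`, `pencilUpper_ge_pointwise'`). This is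
  the form that covers EVERY fixed-feasible-set class (DQG, DQGT1, DQGT1T2, DQGT1T2′, the spin-flip
  quotients, …) verbatim: at the optimiser `x_A` of `A`'s relaxation it reads «lower leg ≤ P_A −
  Re E_B(x_A) ≤ P_A − P_B», i.e. «relaxation errors add linearly» (LADDER-CHEM.md v1.7 §2).

Doors and what the barrier does NOT say: see part 2 (`DifferencePencilCeilingDQG.lean`), whose header
carries the measured κ law of chem-solver-4 / chem-solver-6 as locators.

References (tree, REUSED — imported, nothing restated): chem-type-09 `Rows/DifferencePencilRows.lean`
(`Model.lincomb`, `Model.energy_pencil_le`, `diffLowerRow_of_pencil_of_upperRow`,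
`diffUpperRow_of_pencil_of_upperRow`); chem-type-01 `Rows/LinearCombination.lean` (`lincomb_h/eri/ecore`,
`energy_lincomb_ge` = superadditivity of the EXACT energy); `Rows/RelaxationValueConcavity.lean`
(`rdmEnergy_line`: linearity of the functional along a line of tables); `Rows/ConjectureSU.lean`
(spelling `Model.pqgSectorEnergy`, used from part 2 on); Literature `RelaxationEnergyHierarchy`. Print
context for the objects: M. Nakata et al., J. Chem. Phys. 128 (2008) 164113 §II.A–C (the values as minima
of a linear functional over a fixed convex set); R. T. Rockafellar, *Convex Analysis* (1970) Thm 5.5.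
-/

noncomputable section

namespace Summit.Ventures.CertifiedQuantumChemistry

open Matrix Finset
open Literature.MathematicalPhysics.QuantumLattice Literature.MathematicalPhysics.QuantumChemistry
open scoped ComplexOrder

/-! ## §1 The energy functional is linear in the table file -/

section Functional

variable {Λ : Type*} [LinearOrder Λ] [Fintype Λ]

omit [LinearOrder Λ] in
/-- The functional of the zero tables vanishes: `E_{0,0,0}(γ, Γ) = 0`. -/
theorem rdmEnergy_zero_tables (γ : Matrix (Orb Λ) (Orb Λ) ℂ)
    (Γ : Matrix (Orb Λ × Orb Λ) (Orb Λ × Orb Λ) ℂ) :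
    rdmEnergy (0 : Λ → Λ → ℂ) (0 : Λ → Λ → Λ → Λ → ℂ) 0 γ Γ = 0 := by
  simp [rdmEnergy]

omit [LinearOrder Λ] in
/-- **Positive (indeed full) homogeneity of the functional in the tables**:
`E_{s·h, s·g, s·c}(γ, Γ) = s · E_{h,g,c}(γ, Γ)` (the case `T₀ = 0` of `rdmEnergy_line`). -/
theorem rdmEnergy_smul_tables (s : ℂ) (h : Λ → Λ → ℂ) (g : Λ → Λ → Λ → Λ → ℂ) (c : ℂ)
    (γ : Matrix (Orb Λ) (Orb Λ) ℂ) (Γ : Matrix (Orb Λ × Orb Λ) (Orb Λ × Orb Λ) ℂ) :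
    rdmEnergy (s • h) (s • g) (s * c) γ Γ = s * rdmEnergy h g c γ Γ := by
  have hl := rdmEnergy_line (0 : Λ → Λ → ℂ) h (0 : Λ → Λ → Λ → Λ → ℂ) g 0 c s γ Γ
  rw [zero_add, zero_add, zero_add, rdmEnergy_zero_tables, zero_add] at hl
  exact hl

end Functional

namespace Model

variable {k : ℕ}

/-- **The cell's energy functional is LINEAR in the table file**: at every abstract pair `(γ, Γ)`,
`E_{α·F + β·G}(γ, Γ) = α·E_F(γ, Γ) + β·E_G(γ, Γ)` for the exact-rational combination file
`Model.lincomb α β F G` (DESIGN.md §1: «K± = exact term-by-term rational combination of the literal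
tables»). The functional is `rdmEnergy` at the `ℂ`-cast tables, as in every `hlo` binder of the cell's
lower-row lemmas. -/
theorem rdmEnergy_lincomb (α β : ℚ) (F G : Model k) (γ : Matrix (Orb (Fin k)) (Orb (Fin k)) ℂ)
    (Γ : Matrix (Orb (Fin k) × Orb (Fin k)) (Orb (Fin k) × Orb (Fin k)) ℂ) :
    rdmEnergy (fun p q => ((lincomb α β F G).h p q : ℂ))
        (fun p q r s => ((lincomb α β F G).eri p q r s : ℂ)) ((lincomb α β F G).ecore : ℂ) γ Γ =
      (α : ℂ) * rdmEnergy (fun p q => (F.h p q : ℂ)) (fun p q r s => (F.eri p q r s : ℂ))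
          (F.ecore : ℂ) γ Γ +
        (β : ℂ) * rdmEnergy (fun p q => (G.h p q : ℂ)) (fun p q r s => (G.eri p q r s : ℂ))
          (G.ecore : ℂ) γ Γ := by
  have eh : (fun p q => (((lincomb α β F G).h p q : ℚ) : ℂ)) =
      (α : ℂ) • (fun p q => (F.h p q : ℂ)) + (β : ℂ) • (fun p q => (G.h p q : ℂ)) := by
    funext p q
    simp only [lincomb, Pi.add_apply, Pi.smul_apply, smul_eq_mul, Rat.cast_add, Rat.cast_mul]
  have eg : (fun p q r s => (((lincomb α β F G).eri p q r s : ℚ) : ℂ)) =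
      (α : ℂ) • (fun p q r s => (F.eri p q r s : ℂ)) +
        (β : ℂ) • (fun p q r s => (G.eri p q r s : ℂ)) := by
    funext p q r s
    simp only [lincomb, Pi.add_apply, Pi.smul_apply, smul_eq_mul, Rat.cast_add, Rat.cast_mul]
  have ec : (((lincomb α β F G).ecore : ℚ) : ℂ) =
      (α : ℂ) * (F.ecore : ℂ) + (β : ℂ) * (G.ecore : ℂ) := by
    simp only [lincomb, Rat.cast_add, Rat.cast_mul]
  rw [eh, eg, ec, rdmEnergy_line, rdmEnergy_smul_tables]

/-- Real parts: `Re E_{α·F + β·G}(γ, Γ) = α·Re E_F(γ, Γ) + β·Re E_G(γ, Γ)` (rational, hence real,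
coefficients). -/
theorem re_rdmEnergy_lincomb (α β : ℚ) (F G : Model k) (γ : Matrix (Orb (Fin k)) (Orb (Fin k)) ℂ)
    (Γ : Matrix (Orb (Fin k) × Orb (Fin k)) (Orb (Fin k) × Orb (Fin k)) ℂ) :
    (rdmEnergy (fun p q => ((lincomb α β F G).h p q : ℂ))
        (fun p q r s => ((lincomb α β F G).eri p q r s : ℂ)) ((lincomb α β F G).ecore : ℂ) γ Γ).re =
      (α : ℝ) * (rdmEnergy (fun p q => (F.h p q : ℂ)) (fun p q r s => (F.eri p q r s : ℂ))
          (F.ecore : ℂ) γ Γ).re +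
        (β : ℝ) * (rdmEnergy (fun p q => (G.h p q : ℂ)) (fun p q r s => (G.eri p q r s : ℂ))
          (G.ecore : ℂ) γ Γ).re := by
  rw [rdmEnergy_lincomb, Complex.add_re, Complex.mul_re, Complex.mul_re, Complex.ratCast_re,
    Complex.ratCast_im, Complex.ratCast_re, Complex.ratCast_im, zero_mul, sub_zero, zero_mul, sub_zero]

/-- **The pencil file's functional**: `Re E_{c·F − G}(γ, Γ) = c·Re E_F(γ, Γ) − Re E_G(γ, Γ)` for
`K = Model.lincomb c (-1) F G` (the file `K⁺_μ`, `c = 1 + μ`, of a `dE-direct:d` certificate). -/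
theorem re_rdmEnergy_pencil (c : ℚ) (F G : Model k) (γ : Matrix (Orb (Fin k)) (Orb (Fin k)) ℂ)
    (Γ : Matrix (Orb (Fin k) × Orb (Fin k)) (Orb (Fin k) × Orb (Fin k)) ℂ) :
    (rdmEnergy (fun p q => ((lincomb c (-1) F G).h p q : ℂ))
        (fun p q r s => ((lincomb c (-1) F G).eri p q r s : ℂ)) ((lincomb c (-1) F G).ecore : ℂ)
        γ Γ).re =
      (c : ℝ) * (rdmEnergy (fun p q => (F.h p q : ℂ)) (fun p q r s => (F.eri p q r s : ℂ))
          (F.ecore : ℂ) γ Γ).re -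
        (rdmEnergy (fun p q => (G.h p q : ℂ)) (fun p q r s => (G.eri p q r s : ℂ))
          (G.ecore : ℂ) γ Γ).re := by
  rw [re_rdmEnergy_lincomb, Rat.cast_neg, Rat.cast_one, neg_one_mul, sub_eq_add_neg]

end Model

/-! ## §2 Pointwise ceiling and floor — any relaxation class, no infimum

Throughout, `E_F(x)` abbreviates (in words only) the real functional
`(rdmEnergy (F.h·) (F.eri·) F.ecore γ Γ).re` of the file `F` at the abstract pair `x = (γ, Γ)`. -/

section Pointwise

variable {k : ℕ}

/-- **POINTWISE CEILING OF THE PENCIL LOWER LEG (the additivity floor at one pair).** If the pencil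
value `ℓ` of `K = c·F_A − F_B` is certified at the abstract pair `x = (γ, Γ)` — `ℓ ≤ Re E_K(x)`, which
every certificate «`ℓ ≤` the functional on a feasible set containing `x`» delivers — then the
`dE-direct:d` lower leg obeys, for every rational `u_A`,
`ℓ − (c−1)·u_A ≤ [Re E_A(x) − Re E_B(x)] − (c−1)·(u_A − Re E_A(x))`.
Pure linearity (§1); no sign condition on `c`, no symmetry, no feasibility notion. -/
theorem pencilLower_le_pointwise (FA FB : Model k) (c ℓ uA : ℚ)
    (γ : Matrix (Orb (Fin k)) (Orb (Fin k)) ℂ)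
    (Γ : Matrix (Orb (Fin k) × Orb (Fin k)) (Orb (Fin k) × Orb (Fin k)) ℂ)
    (hx : ((ℓ : ℚ) : ℝ) ≤ (rdmEnergy (fun p q => ((Model.lincomb c (-1) FA FB).h p q : ℂ))
        (fun p q r s => ((Model.lincomb c (-1) FA FB).eri p q r s : ℂ))
        ((Model.lincomb c (-1) FA FB).ecore : ℂ) γ Γ).re) :
    ((ℓ - (c - 1) * uA : ℚ) : ℝ) ≤
      ((rdmEnergy (fun p q => (FA.h p q : ℂ)) (fun p q r s => (FA.eri p q r s : ℂ))
            (FA.ecore : ℂ) γ Γ).re -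
          (rdmEnergy (fun p q => (FB.h p q : ℂ)) (fun p q r s => (FB.eri p q r s : ℂ))
            (FB.ecore : ℂ) γ Γ).re) -
        ((c : ℝ) - 1) * ((uA : ℝ) -
          (rdmEnergy (fun p q => (FA.h p q : ℂ)) (fun p q r s => (FA.eri p q r s : ℂ))
            (FA.ecore : ℂ) γ Γ).re) := by
  rw [Model.re_rdmEnergy_pencil] at hx
  push_cast
  linarith

/-- **The pencil lower leg never exceeds the functional difference at a certified pair below the
upper row**: with `c ≥ 1` and `Re E_A(x) ≤ u_A` (e.g. `x` = the optimiser of `A`'s relaxation, or the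
reduced density matrices of `A`'s ground state), `ℓ − (c−1)·u_A ≤ Re E_A(x) − Re E_B(x)`. -/
theorem pencilLower_le_pointwise' (FA FB : Model k) {c : ℚ} (ℓ : ℚ) {uA : ℚ} (hc : 1 ≤ c)
    (γ : Matrix (Orb (Fin k)) (Orb (Fin k)) ℂ)
    (Γ : Matrix (Orb (Fin k) × Orb (Fin k)) (Orb (Fin k) × Orb (Fin k)) ℂ)
    (hx : ((ℓ : ℚ) : ℝ) ≤ (rdmEnergy (fun p q => ((Model.lincomb c (-1) FA FB).h p q : ℂ))
        (fun p q r s => ((Model.lincomb c (-1) FA FB).eri p q r s : ℂ))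
        ((Model.lincomb c (-1) FA FB).ecore : ℂ) γ Γ).re)
    (hu : (rdmEnergy (fun p q => (FA.h p q : ℂ)) (fun p q r s => (FA.eri p q r s : ℂ))
        (FA.ecore : ℂ) γ Γ).re ≤ ((uA : ℚ) : ℝ)) :
    ((ℓ - (c - 1) * uA : ℚ) : ℝ) ≤
      (rdmEnergy (fun p q => (FA.h p q : ℂ)) (fun p q r s => (FA.eri p q r s : ℂ))
          (FA.ecore : ℂ) γ Γ).re -
        (rdmEnergy (fun p q => (FB.h p q : ℂ)) (fun p q r s => (FB.eri p q r s : ℂ))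
          (FB.ecore : ℂ) γ Γ).re := by
  have h := pencilLower_le_pointwise FA FB c ℓ uA γ Γ hx
  have hc' : (0 : ℝ) ≤ (c : ℝ) - 1 := by exact_mod_cast sub_nonneg.2 hc
  have hu' : (0 : ℝ) ≤ ((uA : ℚ) : ℝ) -
      (rdmEnergy (fun p q => (FA.h p q : ℂ)) (fun p q r s => (FA.eri p q r s : ℂ))
        (FA.ecore : ℂ) γ Γ).re := sub_nonneg.2 hu
  have hprod := mul_nonneg hc' hu'
  linarith

/-- **POINTWISE FLOOR OF THE PENCIL UPPER LEG** (roles of `A` and `B` exchanged: `K′ = c′·F_B − F_A`,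
`ℓ′ ≤ Re E_{K′}(y)`): `(c′−1)·u_B − ℓ′ ≥ [Re E_A(y) − Re E_B(y)] + (c′−1)·(u_B − Re E_B(y))`. -/
theorem pencilUpper_ge_pointwise (FA FB : Model k) (c' ℓ' uB : ℚ)
    (γ : Matrix (Orb (Fin k)) (Orb (Fin k)) ℂ)
    (Γ : Matrix (Orb (Fin k) × Orb (Fin k)) (Orb (Fin k) × Orb (Fin k)) ℂ)
    (hy : ((ℓ' : ℚ) : ℝ) ≤ (rdmEnergy (fun p q => ((Model.lincomb c' (-1) FB FA).h p q : ℂ))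
        (fun p q r s => ((Model.lincomb c' (-1) FB FA).eri p q r s : ℂ))
        ((Model.lincomb c' (-1) FB FA).ecore : ℂ) γ Γ).re) :
    ((rdmEnergy (fun p q => (FA.h p q : ℂ)) (fun p q r s => (FA.eri p q r s : ℂ))
            (FA.ecore : ℂ) γ Γ).re -
          (rdmEnergy (fun p q => (FB.h p q : ℂ)) (fun p q r s => (FB.eri p q r s : ℂ))
            (FB.ecore : ℂ) γ Γ).re) +
        ((c' : ℝ) - 1) * ((uB : ℝ) -
          (rdmEnergy (fun p q => (FB.h p q : ℂ)) (fun p q r s => (FB.eri p q r s : ℂ))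
            (FB.ecore : ℂ) γ Γ).re) ≤
      (((c' - 1) * uB - ℓ' : ℚ) : ℝ) := by
  rw [Model.re_rdmEnergy_pencil] at hy
  push_cast
  linarith

/-- With `c′ ≥ 1` and `Re E_B(y) ≤ u_B`: `Re E_A(y) − Re E_B(y) ≤ (c′−1)·u_B − ℓ′` — the pencil upper
leg never undercuts the functional difference at a certified pair below the upper row of `B`. -/
theorem pencilUpper_ge_pointwise' (FA FB : Model k) {c' : ℚ} (ℓ' : ℚ) {uB : ℚ} (hc : 1 ≤ c')
    (γ : Matrix (Orb (Fin k)) (Orb (Fin k)) ℂ)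
    (Γ : Matrix (Orb (Fin k) × Orb (Fin k)) (Orb (Fin k) × Orb (Fin k)) ℂ)
    (hy : ((ℓ' : ℚ) : ℝ) ≤ (rdmEnergy (fun p q => ((Model.lincomb c' (-1) FB FA).h p q : ℂ))
        (fun p q r s => ((Model.lincomb c' (-1) FB FA).eri p q r s : ℂ))
        ((Model.lincomb c' (-1) FB FA).ecore : ℂ) γ Γ).re)
    (hu : (rdmEnergy (fun p q => (FB.h p q : ℂ)) (fun p q r s => (FB.eri p q r s : ℂ))
        (FB.ecore : ℂ) γ Γ).re ≤ ((uB : ℚ) : ℝ)) :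
    (rdmEnergy (fun p q => (FA.h p q : ℂ)) (fun p q r s => (FA.eri p q r s : ℂ))
          (FA.ecore : ℂ) γ Γ).re -
        (rdmEnergy (fun p q => (FB.h p q : ℂ)) (fun p q r s => (FB.eri p q r s : ℂ))
          (FB.ecore : ℂ) γ Γ).re ≤
      (((c' - 1) * uB - ℓ' : ℚ) : ℝ) := by
  have h := pencilUpper_ge_pointwise FA FB c' ℓ' uB γ Γ hy
  have hc' : (0 : ℝ) ≤ (c' : ℝ) - 1 := by exact_mod_cast sub_nonneg.2 hc
  have hu' : (0 : ℝ) ≤ ((uB : ℚ) : ℝ) -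
      (rdmEnergy (fun p q => (FB.h p q : ℂ)) (fun p q r s => (FB.eri p q r s : ℂ))
        (FB.ecore : ℂ) γ Γ).re := sub_nonneg.2 hu
  have hprod := mul_nonneg hc' hu'
  linarith

end Pointwise

end Summit.Ventures.CertifiedQuantumChemistry

end
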